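import Summits.ABC.StewartYu.KummerThirdDoor
import Summits.ABC.ABC.Theorems.PadicPrimesKummerThirdY07Odd
import Summits.ABC.ABC.Theorems.PadicPrimesKummerThirdY07Two
import Summits.ABC.ABC.Theorems.CuspFieldPencilGoldenFromNFPencil
import Literature.NumberTheory.DiophantineGeometry.Matveev2000LinearFormsLogMain
import Literature.NumberTheory.DiophantineGeometry.AbcTwoAdicValuationProofs
import HarnessLib

/-!
# STUB-IDEAS sketch · `stub_splitCuspTriple` · ideator k2 (GEN 2) — FAMILY 2 (RESHAPE)

Crux `GoldenCuspShadow` (stmt-ABC-26026), route `CuspFieldPencil`, skeleton sha a4ca286a….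
Elaboration-only sketch: every `sorry` below is a PROPOSED HELPER LEMMA (one prover cycle each);
the sorry-free declarations (`exists_placeBounds_y07`, `symm_prod`, the `_of_matveev` compositions)
certify that the tree inputs compose as claimed.

THE RESHAPE.  Replace the cusp-field `S`-unit equation over `ℚ(√5)` (current line, conditional on the
Scoones-2021 NF fact) by TWO auxiliary COPRIME RATIONAL abc triples
  `T_u :  w² + Q = u(u − 11w)`,   `T_w :  u² − Q = w(11u + w)`,   `Q = u² − 11uw − w²`
(`T_w` is `T_u` at `(u, w) ↦ (w, −u)`, which fixes `u·w·Q` and sends `Q ↦ −Q`).  NEW TOOL the new form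
admits: the tree's KERNEL-PROVED rational `p`-adic place bounds of Yu-2007 quality
(`KummerThird.placeBound_a_of_y07At` / `placeBound_c_of_y07At` fed by `Y07Odd_proof`, `Y07Two_proof`)
at the primes of `u` (member `u(u−11w)` of `T_u`: its theta lives on the OTHER two members `w², |Q|`
only — `rad(u − 11w)` never enters) and at the primes of `w` (symmetrically), plus ONE archimedean
linear form in logarithms of the rational primes of `uQ` (`Λ = log(u²/Q)`, tiny when `|w| ≤ |u|/48`)
bounded by Matveev 2000 Cor. 2.3 over `ℚ` (`Dioph.matveev2000_linearFormsLog_primes'`, PROVED modulo the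
named fact `Dioph.matveev2000_linearFormsLog_rat` = [EvertseGyory2015, Thm 3.2.4]).
OUTPUT: `CuspMinRadBound` (log H ≪_ε R^ε · min(rad u, rad w)) ⇒ the stub AND the whole crux, modulo
Matveev-over-ℚ only; the balanced regime `|u|/48 ≤ |w| ≤ 48|u|` is UNCONDITIONAL.
-/

set_option linter.dupNamespace false

open Finset
open Literature.NumberTheory.DiophantineGeometry
open Literature.NumberTheory.DiophantineGeometry.Dioph
open Literature.NumberTheory.DiophantineGeometry.Pasten
open Literature.Barriers.ABC
open Summit.ABC.StewartYu.KummerThird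
open Summit.ABC.ABC.Theorems

namespace Summit.ABC.ABC.Cruxes.GoldenCuspShadow.SplitK2G2

/-! ## 0 · The stub (verbatim) and the reshape target -/

/-- The registered stub signature `stub_splitCuspTriple`, verbatim. -/
def StubSplit : Prop :=
  ∀ ε : ℝ, 0 < ε → ∃ κ : ℝ, ∀ u w : ℤ, IsCoprime u w → u * w * (u ^ 2 - 11 * u * w - w ^ 2) ≠ 0 → Real.log (max (|(u : ℝ)|) (|(w : ℝ)|)) ≤ κ * (((UniqueFactorizationMonoid.radical (u * w * (u ^ 2 - 11 * u * w - w ^ 2))).natAbs : ℕ) : ℝ) ^ (ε : ℝ) * (((((UniqueFactorizationMonoid.radical u).natAbs : ℕ) : ℝ) * (((UniqueFactorizationMonoid.radical w).natAbs : ℕ) : ℝ)) ^ (2 / 3 : ℝ) * (((UniqueFactorizationMonoid.radical (u ^ 2 - 11 * u * w - w ^ 2)).natAbs : ℕ) : ℝ) ^ (1 / 3 : ℝ))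

/-- RESHAPE TARGET `CuspMinRadBound`: `log max(|u|,|w|) ≤ κ_ε · rad(uwQ)^ε · min(rad u, rad w)`.
It implies the stub (`min(x,y) ≤ (xy)^{1/2} ≤ (xy)^{2/3}`, `rad(Q)^{1/3} ≥ 1`) and the crux
(`min(rad u, rad w) ≤ (rad u · rad w)^{1/2} ≤ R^{1/2}`). -/
def CuspMinRadBound : Prop :=
  ∀ ε : ℝ, 0 < ε → ∃ κ : ℝ, ∀ u w : ℤ, IsCoprime u w → u * w * (u ^ 2 - 11 * u * w - w ^ 2) ≠ 0 →
    Real.log (max (|(u : ℝ)|) (|(w : ℝ)|)) ≤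
      κ * (((UniqueFactorizationMonoid.radical (u * w * (u ^ 2 - 11 * u * w - w ^ 2))).natAbs : ℕ) : ℝ) ^ (ε : ℝ) *
        min ((((UniqueFactorizationMonoid.radical u).natAbs : ℕ) : ℝ))
            ((((UniqueFactorizationMonoid.radical w).natAbs : ℕ) : ℝ))

/-- R1 (S, real arithmetic): the reshape target gives the stub.  All radicals are `≥ 1`
(`Int.radical_pos`); `min x y ≤ (x*y)^{1/2} ≤ (x*y)^{2/3}` for `x, y ≥ 1`; `z^{1/3} ≥ 1`. -/
theorem stubSplit_of_cuspMinRadBound : CuspMinRadBound → StubSplit := by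
  sorry

/-- R2 (S): the reshape target gives the CRUX (`min ≤ (rad u·rad w)^{1/2} ≤ R^{1/2}` by
`GoldenFromNFPencil.natAbs_radical_prod`; exponent `1/2 + ε`). -/
theorem goldenCuspShadow_of_cuspMinRadBound :
    CuspMinRadBound → Summit.ABC.ABC.Theses.CuspFieldPencil.GoldenCuspShadow := by
  sorry

/-! ## 1 · p-adic side (UNCONDITIONAL inputs) -/

/-- H0 (XS, cast bookkeeping): `(radical z).natAbs`, as a real, is the product of the rational primes of `z`
(`Int.radical_natAbs_eq_radical`, `Nat.radical_eq_prod_primeFactors`, `Nat.cast_prod`). -/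
theorem natAbs_radical_cast (z : ℤ) :
    (((UniqueFactorizationMonoid.radical z).natAbs : ℕ) : ℝ) = ∏ p ∈ z.natAbs.primeFactors, (p : ℝ) := by
  sorry

/-- H1a (S): DIVISOR form of the route through `a` (`log_le_route_a₂_placeBounds`, same proof with
`ν_p(d) ≤ ν_p(a)` for `d ∣ a`): only the primes of `d` are summed. -/
theorem log_divisor_le_route_a_placeBounds {K : ℝ} (hK : 1 ≤ K)
    (hpad : ∀ {a b c : ℕ}, IsABCTriple a b c → ∀ {p : ℕ}, p.Prime → p ∣ a →
      (a.factorization p : ℝ) * Real.log p < theta K b c 0 *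
        ((p / Real.log p) * (Real.log p + Real.log (max (Real.exp 1) (2 * Real.log c)))))
    {a b c : ℕ} (h : IsABCTriple a b c) {d : ℕ} (hd : d ∣ a) :
    Real.log d ≤ theta K b c 0 * Real.log (max (Real.exp 1) (2 * Real.log c)) *
      (3 * ∑ p ∈ d.primeFactors, (p : ℝ)) := by
  sorry

/-- H1c (S): DIVISOR form of the route through `c` (`log_lt_route_c₂_placeBounds`; needs `1 < ab`). -/
theorem log_divisor_le_route_c_placeBounds {K : ℝ} (hK : 1 ≤ K)
    (hpadc : ∀ {a b c : ℕ}, IsABCTriple a b c → 1 < a * b → ∀ {p : ℕ}, p.Prime → p ∣ c →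
      (c.factorization p : ℝ) * Real.log p < theta K a b 0 *
        ((p / Real.log p) * (Real.log p + Real.log (max (Real.exp 1) (2 * Real.log c)))))
    {a b c : ℕ} (h : IsABCTriple a b c) (h1 : 1 < a * b) {d : ℕ} (hd : d ∣ c) :
    Real.log d ≤ theta K a b 0 * Real.log (max (Real.exp 1) (2 * Real.log c)) *
      (3 * ∑ p ∈ d.primeFactors, (p : ℝ)) := by
  sorry

/-- H1′ (PROVED here — certifies that the unconditional inputs compose): the two place-bound binders of
H1a/H1c hold with `K = max 4 C`, from the kernel theorems `Y07Odd_proof`, `Y07Two_proof`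
(pattern of `KummerThird.BakerMethodBounds_of_y07`). -/
theorem exists_placeBounds_y07 : ∃ C : ℝ, 0 ≤ C ∧
    (∀ {a b c : ℕ}, IsABCTriple a b c → ∀ {p : ℕ}, p.Prime → p ∣ a →
      (a.factorization p : ℝ) * Real.log p < theta (max 4 C) b c 0 *
        ((p / Real.log p) * (Real.log p + Real.log (max (Real.exp 1) (2 * Real.log c))))) ∧
    (∀ {a b c : ℕ}, IsABCTriple a b c → 1 < a * b → ∀ {p : ℕ}, p.Prime → p ∣ c →
      (c.factorization p : ℝ) * Real.log p < theta (max 4 C) a b 0 *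
        ((p / Real.log p) * (Real.log p + Real.log (max (Real.exp 1) (2 * Real.log c))))) := by
  obtain ⟨C, hC0, hY⟩ := y07At_of_odd_two Y07Odd_proof Y07Two_proof
  exact ⟨C, hC0, fun h _ hp hpa => placeBound_a_of_y07At hC0 h hp (hY _ hp) hpa,
    fun h h1 _ hp hpc => placeBound_c_of_y07At hC0 h h1 hp (hY _ hp) hpc⟩

/-- H2 (M, elementary sign/case analysis): the auxiliary triple `T_u : w² + Q = u(u−11w)` normalised to
an `IsABCTriple a b c` (ℕ, `a + b = c`, coprime): the member `|u(u−11w)|` is `a` or `c`, the other two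
members are `{w², |Q|}` (so their theta is supported on the primes of `wQ`), and `c ≤ 13·H²`.
Cases: `Q > 0 ⇒ w² + Q = U (U = c, and 1 < ab unless no solution)`; `Q < 0, u(u−11w) > 0 ⇒ U + |Q| = w²`;
`Q < 0, u(u−11w) < 0 ⇒ U + w² = |Q|`; `u = 11w ⇒ (u,w) = ±(11,1)`, the escape disjunct. -/
theorem auxTriple_u {u w : ℤ} (hcop : IsCoprime u w) (hne : u * w * (u ^ 2 - 11 * u * w - w ^ 2) ≠ 0) :
    u.natAbs ≤ 12 ∨
    ∃ a b c : ℕ, IsABCTriple a b c ∧ (c : ℝ) ≤ 13 * (max (|(u : ℝ)|) (|(w : ℝ)|)) ^ 2 ∧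
      ((u.natAbs ∣ a ∧ b * c = (w ^ 2 * (u ^ 2 - 11 * u * w - w ^ 2)).natAbs) ∨
       (u.natAbs ∣ c ∧ 1 < a * b ∧ a * b = (w ^ 2 * (u ^ 2 - 11 * u * w - w ^ 2)).natAbs)) := by
  sorry

/-- H3 (S): ABSORPTION `theta K x y 0 ≤ C_{K,δ} · rad(xy)^δ` — `theta_zero_le_mul_prod` (with `n = x*y`)
then `prod_primeFactors_le_pow_mul_rpow` with `g q = 2K·max 1 (log q)` (`g q ≤ q^δ` for `q ≥ T(K,δ)`). -/
theorem theta_le_mul_rad_rpow {K : ℝ} (hK : 1 ≤ K) {δ : ℝ} (hδ : 0 < δ) :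
    ∃ C : ℝ, 0 ≤ C ∧ ∀ {x y : ℕ}, x ≠ 0 → y ≠ 0 → x.Coprime y →
      theta K x y 0 ≤ C * (∏ p ∈ (x * y).primeFactors, (p : ℝ)) ^ δ := by
  sorry

/-- H3′ (XS): `∑_{p ∣ n} p ≤ ∏_{p ∣ n} p` (all prime factors are `≥ 2`; induction on the finset). -/
theorem sum_primeFactors_le_prod (n : ℕ) :
    ∑ p ∈ n.primeFactors, (p : ℝ) ≤ ∏ p ∈ n.primeFactors, (p : ℝ) := by
  sorry

/-- HA (M, the p-adic bound at `u`; UNCONDITIONAL): `log|u| ≤ C_δ · R^δ · (1 + log(1 + log H)) · rad(u)`.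
Assembly: H2 → (escape: `log 12 ≤ C`) | triple; H1a/H1c with H1′ and `d = |u|`; `Θ ≤ C·rad(w²Q)^δ ≤ C·R^δ`
(H3, H0, `Finset.prod_le_prod_of_subset_of_one_le'`); `Y = log max(e, 2 log c) ≤ 2(1 + log(1 + log H))`
from `c ≤ 13H²`; `3∑_{p∣u} p ≤ 3·rad u` (H3′, H0).  (Free upgrade: `∑_{p∣u} p ≤ ω(u)·P(u)`.) -/
theorem log_abs_le_padic : ∀ δ : ℝ, 0 < δ → ∃ C : ℝ, ∀ u w : ℤ, IsCoprime u w →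
    u * w * (u ^ 2 - 11 * u * w - w ^ 2) ≠ 0 →
    Real.log |(u : ℝ)| ≤
      C * (((UniqueFactorizationMonoid.radical (u * w * (u ^ 2 - 11 * u * w - w ^ 2))).natAbs : ℕ) : ℝ) ^ δ *
        (1 + Real.log (1 + Real.log (max (|(u : ℝ)|) (|(w : ℝ)|)))) *
        (((UniqueFactorizationMonoid.radical u).natAbs : ℕ) : ℝ) := by
  sorry

/-- H5 (XS, PROVED): the symmetry `(u, w) ↦ (w, −u)` fixes `u·w·Q` (and sends `Q ↦ −Q`). -/
theorem symm_prod (u w : ℤ) :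
    w * (-u) * (w ^ 2 - 11 * w * (-u) - (-u) ^ 2) = u * w * (u ^ 2 - 11 * u * w - w ^ 2) := by
  ring

/-- HB (S from HA + H5): the p-adic bound at `w` — HA at `(w, −u)` (`hcop.symm.neg_right`, `symm_prod`,
`Int.cast_neg`, `abs_neg`, `max_comm`, `UniqueFactorizationDomain.radical_neg`). -/
theorem log_abs_le_padic_w : ∀ δ : ℝ, 0 < δ → ∃ C : ℝ, ∀ u w : ℤ, IsCoprime u w →
    u * w * (u ^ 2 - 11 * u * w - w ^ 2) ≠ 0 →
    Real.log |(w : ℝ)| ≤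
      C * (((UniqueFactorizationMonoid.radical (u * w * (u ^ 2 - 11 * u * w - w ^ 2))).natAbs : ℕ) : ℝ) ^ δ *
        (1 + Real.log (1 + Real.log (max (|(u : ℝ)|) (|(w : ℝ)|)))) *
        (((UniqueFactorizationMonoid.radical w).natAbs : ℕ) : ℝ) := by
  sorry

/-! ## 2 · archimedean side (the ONLY conditional input: Matveev 2000 Cor. 2.3 over `ℚ`) -/

/-- H4a (S, elementary): in the regime `48|w| ≤ |u|` one has `Q > u²/2 > 0`, `u² − Q = w(11u + w) ≠ 0`,
`|u²/Q − 1| ≤ 24|w|/|u| ≤ 1/2`, hence `0 < |log(u²/Q)| ≤ 48|w|/|u|`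
(`Real.abs_log_sub_add_sum_range_le` with `n = 0`, or `Real.add_one_le_exp` both ways). -/
theorem arch_small {u w : ℤ} (hu : u ≠ 0) (hw : w ≠ 0) (hw48 : 48 * |(w : ℝ)| ≤ |(u : ℝ)|) :
    (0 : ℝ) < ((u ^ 2 - 11 * u * w - w ^ 2 : ℤ) : ℝ) ∧
    (u : ℝ) ^ 2 / ((u ^ 2 - 11 * u * w - w ^ 2 : ℤ) : ℝ) ≠ 1 ∧
    |Real.log ((u : ℝ) ^ 2 / ((u ^ 2 - 11 * u * w - w ^ 2 : ℤ) : ℝ))| ≤ 48 * |(w : ℝ)| / |(u : ℝ)| := by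
  sorry

/-- H4b (S): `log(m/n)` as a linear form in the logarithms of the rational primes of `mn` with integer
coefficients `ν_q(m) − ν_q(n)` (`log_eq_sum_factorization_mul_log` twice, sums extended to `(m*n).primeFactors`
by `Nat.factorization_eq_zero_of_not_dvd`); coefficient bound `|ν_q(m) − ν_q(n)| ≤ log(max m n)/log 2`. -/
theorem log_div_eq_sum_primeFactors {m n : ℕ} (hm : m ≠ 0) (hn : n ≠ 0) :
    Real.log ((m : ℝ) / n) =
      ∑ q ∈ (m * n).primeFactors, (((m.factorization q : ℤ) - (n.factorization q : ℤ) : ℤ) : ℝ) * Real.log (q : ℝ) ∧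
    ∀ q ∈ (m * n).primeFactors,
      (|((m.factorization q : ℤ) - (n.factorization q : ℤ) : ℤ)| : ℝ) ≤ Real.log (max (m : ℝ) n) / Real.log 2 := by
  sorry

/-- H4c (M, mod Matveev — a reusable "Matveev for a ratio of coprime integers, radical form"):
for coprime `m, n ≥ 2`, `−log|log(m/n)| ≤ C_δ · rad(mn)^δ · (1 + log(1 + log max(m,n)))`.
Proof: H4b; `S = (m*n).primeFactors` has `#S ≥ 2` (coprime, both `≥ 2`), `Λ ≠ 0` (`m ≠ n`), some `e_q ≠ 0`;
`matveev2000_linearFormsLog_primes' hM` with `B = max 1 (log(max m n)/log 2)`; the constant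
`min(…, 2^{6#S+20})·∏ log q ≤ 2^{20}·∏_{q∣mn}(64·log q) ≤ 2^{20}·C·rad(mn)^δ` by `prod_primeFactors_le_pow_mul_rpow`. -/
theorem neg_log_abs_log_div_le (hM : matveev2000_linearFormsLog_rat) {δ : ℝ} (hδ : 0 < δ) :
    ∃ C : ℝ, 0 ≤ C ∧ ∀ m n : ℕ, 2 ≤ m → 2 ≤ n → m.Coprime n →
      -Real.log |Real.log ((m : ℝ) / n)| ≤
        C * (∏ p ∈ (m * n).primeFactors, (p : ℝ)) ^ δ * (1 + Real.log (1 + Real.log (max (m : ℝ) n))) := by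
  sorry

/-- H4 (M, mod Matveev — the ARCHIMEDEAN TRANSFER): for `|w| ≤ |u|`,
`log|u| ≤ log|w| + C_δ · R^δ · (1 + log(1 + log H))`.
Regime `|u| < 48|w|`: trivial with `C ≥ log 48`.  Regime `48|w| ≤ |u|`: H4a gives `log|u| − log|w| ≤ log 48 − log|Λ|`,
`Λ = log(u²/Q)`; H4c with `m = |u|², n = Q` (coprime by `GoldenFromNFPencil.isCoprime_quadForm_left`, `m ≥ 48²`,
`n ≥ u²/2 ≥ 2`), and `rad(u²Q) = rad(uQ) ≤ R` (H0, primeFactors of `u²Q ⊆` those of `uwQ`). -/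
theorem arch_transfer (hM : matveev2000_linearFormsLog_rat) : ∀ δ : ℝ, 0 < δ → ∃ C : ℝ, ∀ u w : ℤ, IsCoprime u w →
    u * w * (u ^ 2 - 11 * u * w - w ^ 2) ≠ 0 → |(w : ℝ)| ≤ |(u : ℝ)| →
    Real.log |(u : ℝ)| ≤ Real.log |(w : ℝ)| +
      C * (((UniqueFactorizationMonoid.radical (u * w * (u ^ 2 - 11 * u * w - w ^ 2))).natAbs : ℕ) : ℝ) ^ δ *
        (1 + Real.log (1 + Real.log (max (|(u : ℝ)|) (|(w : ℝ)|)))) := by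
  sorry

/-! ## 3 · endgame and assembly -/

/-- H6 (S, real analysis — removes the `log log H` loss, "weaken-and-bootstrap"):
`x ≤ A·(1 + log(1 + x))`, `A ≥ 1` ⇒ `x ≤ C_η · A^{1+η}` (`Real.log_le_rpow_div`, `Real.add_one_le_exp`). -/
theorem endgame {η : ℝ} (hη : 0 < η) : ∃ C : ℝ, 0 < C ∧ ∀ x A : ℝ, 0 ≤ x → 1 ≤ A →
    x ≤ A * (1 + Real.log (1 + x)) → x ≤ C * A ^ (1 + η) := by
  sorry

/-- H7 (M, ASSEMBLY of the reshape target from the three analytic inputs): WLOG `|w| ≤ |u| = H` (else swap by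
H5: `symm_prod`, `max_comm`, `radical_neg`); HA: `log H ≤ C R^δ Y rad u`; arch + HB: `log H ≤ (C+C') R^δ Y rad w`
(`rad w ≥ 1`); so `log H ≤ C″ R^δ Y min`, `Y = 1 + log(1 + log H)`; H6 with `A = C″ R^δ min`; finally
`min^{1+η} ≤ min · R^η` (`min ≤ R`) and `δ(1+η) + η ≤ ε` (`δ = η = ε/4`, `R ≥ 1`, `Real.rpow_le_rpow_of_exponent_le`). -/
theorem cuspMinRadBound_of_parts
    (hA : ∀ δ : ℝ, 0 < δ → ∃ C : ℝ, ∀ u w : ℤ, IsCoprime u w →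
      u * w * (u ^ 2 - 11 * u * w - w ^ 2) ≠ 0 →
      Real.log |(u : ℝ)| ≤
        C * (((UniqueFactorizationMonoid.radical (u * w * (u ^ 2 - 11 * u * w - w ^ 2))).natAbs : ℕ) : ℝ) ^ δ *
          (1 + Real.log (1 + Real.log (max (|(u : ℝ)|) (|(w : ℝ)|)))) *
          (((UniqueFactorizationMonoid.radical u).natAbs : ℕ) : ℝ))
    (hB : ∀ δ : ℝ, 0 < δ → ∃ C : ℝ, ∀ u w : ℤ, IsCoprime u w →
      u * w * (u ^ 2 - 11 * u * w - w ^ 2) ≠ 0 →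
      Real.log |(w : ℝ)| ≤
        C * (((UniqueFactorizationMonoid.radical (u * w * (u ^ 2 - 11 * u * w - w ^ 2))).natAbs : ℕ) : ℝ) ^ δ *
          (1 + Real.log (1 + Real.log (max (|(u : ℝ)|) (|(w : ℝ)|)))) *
          (((UniqueFactorizationMonoid.radical w).natAbs : ℕ) : ℝ))
    (hC : ∀ δ : ℝ, 0 < δ → ∃ C : ℝ, ∀ u w : ℤ, IsCoprime u w →
      u * w * (u ^ 2 - 11 * u * w - w ^ 2) ≠ 0 → |(w : ℝ)| ≤ |(u : ℝ)| →
      Real.log |(u : ℝ)| ≤ Real.log |(w : ℝ)| +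
        C * (((UniqueFactorizationMonoid.radical (u * w * (u ^ 2 - 11 * u * w - w ^ 2))).natAbs : ℕ) : ℝ) ^ δ *
          (1 + Real.log (1 + Real.log (max (|(u : ℝ)|) (|(w : ℝ)|))))) :
    CuspMinRadBound := by
  sorry

/-- THE LINE, composed (kernel-checked modulo the sorried helpers): the reshape target modulo Matveev-over-ℚ. -/
theorem cuspMinRadBound_of_matveev (hM : matveev2000_linearFormsLog_rat) : CuspMinRadBound :=
  cuspMinRadBound_of_parts log_abs_le_padic log_abs_le_padic_w (arch_transfer hM)

/-- DELIVERABLE 1 (land `--supports stmt-ABC-26026 --as helper`): the stub modulo Matveev-over-ℚ. -/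
theorem stubSplit_of_matveev (hM : matveev2000_linearFormsLog_rat) : StubSplit :=
  stubSplit_of_cuspMinRadBound (cuspMinRadBound_of_matveev hM)

/-- DELIVERABLE 2 (flag for the lead): the whole CRUX modulo Matveev-over-ℚ (a textbook fact of record,
[EvertseGyory2015, Thm 3.2.4]) instead of the Scoones-2021 number-field fact. -/
theorem goldenCuspShadow_of_matveev (hM : matveev2000_linearFormsLog_rat) :
    Summit.ABC.ABC.Theses.CuspFieldPencil.GoldenCuspShadow :=
  goldenCuspShadow_of_cuspMinRadBound (cuspMinRadBound_of_matveev hM)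

/-- DELIVERABLE 0 (UNCONDITIONAL, M): the BALANCED regime `|u| ≤ 48|w| ∧ |w| ≤ 48|u|` of the reshape target
needs no archimedean input at all (HA + HB + `|log|u| − log|w|| ≤ log 48` + H6). -/
theorem cuspMinRadBound_balanced : ∀ ε : ℝ, 0 < ε → ∃ κ : ℝ, ∀ u w : ℤ, IsCoprime u w →
    u * w * (u ^ 2 - 11 * u * w - w ^ 2) ≠ 0 → |(u : ℝ)| ≤ 48 * |(w : ℝ)| → |(w : ℝ)| ≤ 48 * |(u : ℝ)| →
    Real.log (max (|(u : ℝ)|) (|(w : ℝ)|)) ≤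
      κ * (((UniqueFactorizationMonoid.radical (u * w * (u ^ 2 - 11 * u * w - w ^ 2))).natAbs : ℕ) : ℝ) ^ (ε : ℝ) *
        min ((((UniqueFactorizationMonoid.radical u).natAbs : ℕ) : ℝ))
            ((((UniqueFactorizationMonoid.radical w).natAbs : ℕ) : ℝ)) := by
  sorry

end Summit.ABC.ABC.Cruxes.GoldenCuspShadow.SplitK2G2
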